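import Mathlib.Algebra.Homology.DerivedCategory.Ext.ExtClass
import Mathlib.Algebra.Homology.DerivedCategory.TStructure
import Mathlib.Algebra.Homology.DerivedCategory.FullyFaithful
import Mathlib.Algebra.Homology.DerivedCategory.HomologySequence
import Mathlib.CategoryTheory.Triangulated.TStructure.AbelianSubcategory
import HarnessLib

/-!
# Every class in `Ext¹` is the class of a short exact sequence; `extClass = 0` implies split

For an abelian category `C` (with `HasExt.{w} C`, Mathlib's `Ext` via the derived category) and
objects `A B : C`:

* `Ext.exists_shortExact_extClass_eq` — every `e : Ext B A 1` is `hS.extClass` for some short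
  exact sequence `0 → A → X → B → 0` (Yoneda's description of `Ext¹`; for the derived-category
  `Ext` this is the statement that the heart of the canonical t-structure on `D(C)` is stable under
  extensions: complete `e : B[0] → A[0]⟦1⟧` to a distinguished triangle `A[0] → Y → B[0] → A[0]⟦1⟧`,
  observe that `Y` has cohomology only in degree `0`, hence `Y ≅ X[0]`, read off the short exact
  sequence with the kernel/cokernel criterion for distinguished triangles of objects of the heart,
  and compare the third morphisms of the two distinguished triangles on `A[0] → X[0] → B[0]`).
* `ShortExact.splitting_of_extClass_eq_zero` — if `hS.extClass = 0` then `S` splits (the triangle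
  `A[0] → X[0] → B[0] →0 A[0]⟦1⟧` has a section of `X[0] → B[0]`).

Mathlib (this pin) has `ShortExact.extClass` (the class OF an extension) and its naturality, but
not the converse construction nor the splitting criterion.

## References

* C. Weibel, *An introduction to homological algebra*, CUP (1994), Thm. 3.4.3, Vista 3.4.6 and
  §10.4 / Cor. 10.7.5 (`Ext¹` and extensions; `Hom_{D}(A, B[1]) = Ext¹(A, B)`).
* A. Beilinson, J. Bernstein, P. Deligne, *Faisceaux pervers*, Astérisque 100 (1982), Thm. 1.3.6.
-/

universe w w' v u

open CategoryTheory CategoryTheory.Limits CategoryTheory.Pretriangulated DerivedCategory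
  CategoryTheory.Abelian

namespace Literature.Algebra.Homology

set_option backward.isDefEq.respectTransparency false
set_option backward.defeqAttrib.useBackward true

variable {C : Type u} [Category.{v} C] [Abelian C]

section Derived

variable [HasDerivedCategory.{w'} C]

/-- There are no non-zero morphisms `X[0] → Y[0]⟦n⟧` in the derived category for `n < 0`
(objects of the heart; the axiom `Hom(D^{≤ 0}, D^{≥ 1}) = 0` of the canonical t-structure).
[folklore] -/
lemma singleFunctor_hom_shift_eq_zero_of_neg {X Y : C} {n : ℤ}
    (f : (singleFunctor C 0).obj X ⟶ ((singleFunctor C 0).obj Y)⟦n⟧) (hn : n < 0) : f = 0 := by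
  have : TStructure.t.IsGE (((singleFunctor C 0).obj Y)⟦n⟧) (-n) :=
    TStructure.t.isGE_shift _ 0 n (-n)
  exact TStructure.t.zero f 0 (-n)

/-- There are no non-zero morphisms `X[0]⟦1⟧ → Y[0]` in the derived category. [folklore] -/
lemma singleFunctor_shift_one_hom_eq_zero {X Y : C}
    (f : ((singleFunctor C 0).obj X)⟦(1 : ℤ)⟧ ⟶ (singleFunctor C 0).obj Y) : f = 0 := by
  have : TStructure.t.IsLE (((singleFunctor C 0).obj X)⟦(1 : ℤ)⟧) (-1) :=
    TStructure.t.isLE_shift _ 0 1 (-1)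
  exact TStructure.t.zero f (-1) 0

/-- A distinguished triangle `A[0] → X[0] → B[0] → A[0]⟦1⟧` whose first two maps come from
`C` yields a short exact sequence `0 → A → X → B → 0` in `C` (kernel and cokernel criteria of
Mathlib's `Triangulated.AbelianSubcategory` for the fully faithful functor `C ⥤ D(C)`).
[folklore] -/
lemma shortExact_of_distTriang {A X B : C} (i : A ⟶ X) (p : X ⟶ B)
    (δ : (singleFunctor C 0).obj B ⟶ ((singleFunctor C 0).obj A)⟦(1 : ℤ)⟧)
    (hT : Triangle.mk ((singleFunctor C 0).map i) ((singleFunctor C 0).map p) δ ∈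
      distTriang (DerivedCategory C)) :
    ∃ (w : i ≫ p = 0), (ShortComplex.mk i p w).ShortExact := by
  have hι : ∀ ⦃X Y : C⦄ ⦃n : ℤ⦄ (f : (singleFunctor C 0).obj X ⟶ ((singleFunctor C 0).obj Y)⟦n⟧),
      n < 0 → f = 0 := fun X Y n f hn => singleFunctor_hom_shift_eq_zero_of_neg f hn
  have w : i ≫ p = 0 := (singleFunctor C 0).map_injective (by
    rw [CategoryTheory.Functor.map_comp, CategoryTheory.Functor.map_zero]
    exact comp_distTriang_mor_zero₁₂ _ hT)
  refine ⟨w, ?_⟩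
  have hK := Triangulated.AbelianSubcategory.isLimitKernelForkOfDistTriang hι i p δ hT
  have hQ := Triangulated.AbelianSubcategory.isColimitCokernelCoforkOfDistTriang hι i p δ hT
  have hmono : Mono i := mono_of_isLimit_fork hK
  have hepi : Epi p := epi_of_isColimit_cofork hQ
  exact { exact := ShortComplex.exact_of_f_is_kernel _ hK }

/-- Two distinguished triangles `A[0] → X[0] → B[0] → A[0]⟦1⟧` on the same pair `(i, p)` have the
same third morphism (the ambiguity is a morphism `A[0]⟦1⟧ → B[0]`, which vanishes). [folklore] -/
lemma mor₃_eq_of_distTriang {A X B : C} (i : A ⟶ X) (p : X ⟶ B)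
    (δ δ' : (singleFunctor C 0).obj B ⟶ ((singleFunctor C 0).obj A)⟦(1 : ℤ)⟧)
    (hT : Triangle.mk ((singleFunctor C 0).map i) ((singleFunctor C 0).map p) δ ∈
      distTriang (DerivedCategory C))
    (hT' : Triangle.mk ((singleFunctor C 0).map i) ((singleFunctor C 0).map p) δ' ∈
      distTriang (DerivedCategory C)) : δ = δ' := by
  obtain ⟨φ, hφ₁, hφ₂⟩ := complete_distinguished_triangle_morphism _ _ hT hT' (𝟙 _) (𝟙 _)
    (by dsimp; rw [Category.comp_id, Category.id_comp])
  dsimp at φ hφ₁ hφ₂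
  -- `φ : B[0] → B[0]` with `p ≫ φ = p` and `δ = φ ≫ δ'`
  have hφ₁' : (singleFunctor C 0).map p ≫ (φ - 𝟙 _) = 0 := by
    rw [Preadditive.comp_sub, Category.comp_id, sub_eq_zero]
    exact hφ₁.trans (Category.id_comp _)
  obtain ⟨ψ, hψ⟩ := Triangle.yoneda_exact₃ _ hT' (φ - 𝟙 _) hφ₁'
  dsimp at ψ hψ
  have hψ0 : ψ = 0 := singleFunctor_shift_one_hom_eq_zero ψ
  rw [hψ0, comp_zero, sub_eq_zero] at hψ
  rw [hψ, Category.id_comp, CategoryTheory.Functor.map_id, Category.comp_id] at hφ₂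
  exact hφ₂

end Derived

variable [HasExt.{w} C]

/-- **Every class in `Ext¹` is the class of an extension**: for `e : Ext¹(B, A)` there is a short
exact sequence `0 → A →i X →p B → 0` with `extClass = e`. [folklore] -/
theorem Ext.exists_shortExact_extClass_eq {A B : C} (e : Ext.{w} B A 1) :
    ∃ (X : C) (i : A ⟶ X) (p : X ⟶ B) (w : i ≫ p = 0) (h : (ShortComplex.mk i p w).ShortExact),
      h.extClass = e := by
  letI := HasDerivedCategory.standard C
  -- complete `e.hom : B[0] → A[0]⟦1⟧` to a distinguished triangle `A[0] → Y → B[0] → A[0]⟦1⟧`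
  obtain ⟨Y, f, g, hT⟩ := distinguished_cocone_triangle₂ (e.hom : _ ⟶ _)
  -- `Y` has cohomology in degree `0` only
  have hY0 : Y.IsGE 0 := by
    rw [isGE_iff]
    intro q hq
    refine (HomologySequence.exact₂ _ hT q).isZero_X₂ ?_ ?_
    · exact (isZero_of_isGE ((singleFunctor C 0).obj A) 0 q hq).eq_of_src _ _
    · exact (isZero_of_isGE ((singleFunctor C 0).obj B) 0 q hq).eq_of_tgt _ _
  have hY1 : Y.IsLE 0 := by
    rw [isLE_iff]
    intro q hq
    refine (HomologySequence.exact₂ _ hT q).isZero_X₂ ?_ ?_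
    · exact (isZero_of_isLE ((singleFunctor C 0).obj A) 0 q hq).eq_of_src _ _
    · exact (isZero_of_isLE ((singleFunctor C 0).obj B) 0 q hq).eq_of_tgt _ _
  obtain ⟨X, ⟨eY⟩⟩ := exists_iso_singleFunctor_obj_of_isGE_of_isLE Y 0
  -- transport the triangle to `A[0] → X[0] → B[0] → A[0]⟦1⟧`
  let i : A ⟶ X := (singleFunctor C 0).preimage (f ≫ eY.hom)
  let p : X ⟶ B := (singleFunctor C 0).preimage (eY.inv ≫ g)
  have hi : (singleFunctor C 0).map i = f ≫ eY.hom := Functor.map_preimage _ _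
  have hp : (singleFunctor C 0).map p = eY.inv ≫ g := Functor.map_preimage _ _
  have h1 : (singleFunctor C 0).map i ≫ eY.inv = 𝟙 _ ≫ f := by
    rw [hi, Category.assoc, Iso.hom_inv_id, Category.comp_id, Category.id_comp]
  have h2 : (singleFunctor C 0).map p ≫ 𝟙 _ = eY.inv ≫ g := by
    rw [hp, Category.comp_id]
  have h3 : e.hom ≫ (shiftFunctor (DerivedCategory C) (1 : ℤ)).map (𝟙 _) = 𝟙 _ ≫ e.hom := by
    rw [CategoryTheory.Functor.map_id]
    exact (Category.comp_id _).trans (Category.id_comp _).symm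
  have hT' : Triangle.mk ((singleFunctor C 0).map i) ((singleFunctor C 0).map p) e.hom ∈
      distTriang (DerivedCategory C) :=
    isomorphic_distinguished _ hT _ (Triangle.isoMk _ _ (Iso.refl _) eY.symm (Iso.refl _) h1 h2 h3)
  obtain ⟨w, hS⟩ := shortExact_of_distTriang i p e.hom hT'
  refine ⟨X, i, p, w, hS, ?_⟩
  -- the two distinguished triangles on `(i, p)` have the same third morphism
  apply Ext.ext
  rw [ShortComplex.ShortExact.extClass_hom]
  exact mor₃_eq_of_distTriang i p _ _ hS.singleTriangle_distinguished hT'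

/-- A short exact sequence whose `Ext¹`-class vanishes is split. [folklore] -/
theorem ShortExact.splitting_of_extClass_eq_zero {S : ShortComplex C} (hS : S.ShortExact)
    (h : hS.extClass = 0) : Nonempty S.Splitting := by
  letI := HasDerivedCategory.standard C
  have hδ : hS.singleδ = 0 := by
    rw [← hS.extClass_hom, h, Ext.zero_hom]
  have hT := hS.singleTriangle_distinguished
  obtain ⟨s, hs⟩ := Triangle.coyoneda_exact₃ _ hT (𝟙 _) (by
    change 𝟙 _ ≫ hS.singleδ = 0
    rw [hδ, comp_zero])
  change (singleFunctor C 0).obj S.X₃ ⟶ (singleFunctor C 0).obj S.X₂ at s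
  change 𝟙 _ = s ≫ (singleFunctor C 0).map S.g at hs
  haveI := hS.mono_f
  refine ⟨ShortComplex.Splitting.ofExactOfSection S hS.exact ((singleFunctor C 0).preimage s)
    ?_ hS.mono_f⟩
  apply (singleFunctor C 0).map_injective
  rw [CategoryTheory.Functor.map_comp, CategoryTheory.Functor.map_preimage,
    CategoryTheory.Functor.map_id]
  exact hs.symm

end Literature.Algebra.Homology
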